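import Literature.MathematicalPhysics.QuantumFieldTheory.Balaban1983to89.B8Ineq159CurvedCubeMemberLocal
import Literature.MathematicalPhysics.QuantumFieldTheory.Balaban1983to89.B8Ineq159CurvedCubeMemberPerCubeTower

/-!
# `Balaban1983to89.B8Ineq159CurvedCubeMemberLocalTower` — [Balaban1985RegularSpaces] (1.59) p. 86 AT A CURVED BACKGROUND ON THE CUBE MEMBER, PER MEMBER,
# ALL TRUNCATIONS `1 ≤ m ≤ k`, WITH THE BACKGROUND CONSTRAINED ONLY NEAR THE MEMBER: locality of the averaging ∕ transpose TOWER in the background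
# ([Balaban1985Averaging] p. 24 «`Ū^k_c` depends only on the bond variables `U_b` for `b ⊂ B^k(c₋) ∪ B^k(c₊)`», (78)–(80) p. 30; [Balaban1985BackgroundPropagators]
# (3.19) p. 393, (3.24) p. 394)

statement-level skeleton of published theorems with citation tags; proofs where landed; nothing here is a claim about the
Yang–Mills mass gap

`[Balaban1985RegularSpaces]` ("B8", CMP **99** (1985) 75–102) (1.29) p. 81, (1.38) p. 82, (1.59) p. 86, (1.62) p. 87, (1.131) p. 99; [B7] = `[Balaban1985Averaging]`
(CMP **98** (1985) 17–51) p. 24 (locality of (42)–(43)), (78)–(80) p. 30, Prop. 2 (52)–(54) p. 26; [4] = `[Balaban1985BackgroundPropagators]` (3.19) p. 393,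
(3.23)–(3.25) p. 394, Thm 3.3 p. 399.

CITATION HEADER (lean-in-tree rule).  Cell `pub-ymgap` (YM Track A, HUMAN RULING D-0062 ∕ D-0149), DAG node N05 = [B8], width seat `pub-ymgap-dag-n05-w3`
(g2), CLAIM-1 file (F′).  WHY.  File (F) localised the truncation-`1` theorem (D): only the level-`0` block transporter `U₀(Γ_{Ly,x})` enters `Q′(U₀)ᵀ` at `m = 1`.
File (D′) (`exists_curved159_perCube`) is the all-truncations theorem in [B7] Prop. 2's averaging-closed regime, with closeness `‖U₀(b) − 1‖ ≤ δ₀` asked on ALL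
bonds of `ℤᵈ`.  THIS FILE proves the locality of the whole tower — the `j`-fold averages `Ū₀ʲ` ([B7] p. 24, `B7Prop1Local.avgIter_congr` BY NAME), the level-`j`
block transporters `T_j(y, x) = Ū₀ʲ(Γ_{Ly,x})` ((78)–(80)), the transposes `Q′_j(U₀)ᵀ` ((3.19)) and `Q′(U₀)ᵀμ` ((3.24)) — and localises (D′): closeness is asked
only on the box `□₀ + (Lᵐ + 3)`.

THE MATHEMATICS (kernel-checked).  §1 `avgIter_agreeOn_block` (backgrounds agreeing on the fine `L^{j+1}`-block of `y` have level-`j` averages agreeing on the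
`L`-block of `y`), `bgT_congr_bg` (the level-`j` transporter `T_j(y(x), x)` reads the fine `L^{j+1}`-block of `y(x)`), `qprimeT1_congr_bg`, `QprimeT_congr_fun`
(`(Q′_jᵀ g)(x)` reads `g` at the level-`j` block index of `x` only), private `blockBox_succ` (nested blocks), `QprimeT_congr_bg` (`(Q′_jᵀ g)(x)` reads `U₀` on the
`Lʲ`-block of `x`), private `inBox_ball_of_block` (that block lies in the ball `[x − (Lʲ−1)𝟙, x + (Lʲ−1)𝟙]`), `QT_congr_bg` (`(Q′(U₀)ᵀμ)(x)` at truncation `m` reads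
`U₀` on the ball of radius `Lᵐ − 1` about `x`).  §2 ★★★ `exists_curved159_perCube_local`:
file (D′)'s theorem with the SAME `δ₀(□, m)`, `B′(□, m)` for `G`-valued backgrounds (`G` averaging-closed, `2 ≤ L`, `L ≤ ρ`) that are `δ₀`-close to `1` ONLY on
the bonds based in `[sqLo₀ − (Lᵐ+3)𝟙, sqHi₀ + (Lᵐ+3)𝟙]`.  PROOF: the background `U₀′ = U₀` on the box, `= 1` off it, is `G`-valued and `δ₀`-close to `1`
everywhere; every hypothesis and target of (D′) for `(U₀′, φ)` equals the one for `(U₀, φ)` (§1, file (F)'s stencil lemmas, `linCovIter_congr`,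
`cubeLamBP_box_subset_pred`); (D′) at `U₀′`.

HONEST SCOPE ∕ A6.  PER MEMBER and per truncation: non-explicit constants; the box `□₀ + (Lᵐ + 3)` is a NEIGHBOURHOOD of `Ω₀ = □₀`, NOT print's `𝔄_k(α₀)`;
`G`-valuedness is still asked on all of `ℤᵈ` (harmless for unitary backgrounds); NOT an inhabitant of `SockB9P3` ∕ `SockH59` as typed; nothing of [4] Thm 3.3's
uniformity.  Non-vacuity: `U₀ = 1`, `φ = 0`.  Count-neutral; N05 NOT discharged; no count claim; one finite `𝕋⁴` programme at fixed `ε`, Bałaban as printed;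
the YM mass gap (Clay) is NOT proved by any of this — R4 closes the conditional finite-`𝕋⁴` rung `BalabanLadder.UV` only; nothing continuum ∕ ℝ⁴ ∕ OS.
No `sorry`, no `def`, no `instance`, no `notation`.  Unit `pub-ymgap-dag-n05-w3` (g2), 2026-08-28.
-/

noncomputable section

namespace Literature.MathematicalPhysics.QuantumFieldTheory.Balaban1983to89.B8Ineq159CurvedCubeMemberLocalTower

open B7Prop1Explicit B7Prop2Explicit B7Prop1Local
open B7Eq78Linearization (conjR conjR_apply)
open B7Prop4GeneralLevels (linCovIter)
open B8Ineq132 (covDerivFwd covDeriv BondTouches)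
open B8Eq140Level (SideTouches)
open B8Eq146AExpansion (iEta)
open B8Eq155JBound (Jcur)
open B8Eq138LandauZd (IsLandau138 covLap covDivB qprimeT1 QprimeT QT)
open B8Eq119TwistedAxial (bgT)
open B8Eq131Cubes (cube sqLo sqHi cube_anti)
open B8Eq131CubesAdmissible (cubeFam cubeFam_false_zero cubeFam_false_of_le)
open B8CubeMemberZd (cubeLamS)
open B8Ineq159FlatCubeMemberPrinted (cubeLamBP cubeLamBP_box_subset_pred cubeLamBP_zero_bondTouches)
open B8Ineq159FlatCubeMemberPerCube (inBox_pred_of_bondTouches inBox_widen_of_sideTouches)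
open B8Ineq159FlatCubeMemberKernel (mem_cube_zero_iff)
open B8Ineq159CurvedCubeMemberPerCubeTower (exists_curved159_perCube)
open B8Ineq159CurvedCubeMemberLocal (covDerivFwd_congr_bg covLap_congr_bg Jcur_congr_bg landauStencil_congr_bg inBox_blockBase_blockMap)
open B9Ineq3137LocalSup (linCovIter_congr)
open B8Ineq130 (axialFn_congr)
open Literature.MathematicalPhysics.QuantumLattice (blockMap blockBase blockMap_one)
open B7BlockGeometry (blockMap_apply blockMap_blockMap)

-- `Site` alone would resolve to the torus sites of `Setup.lean`; re-export the `ℤ^d` sites of `B7Prop1Explicit`.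
export B7Prop1Explicit (Site)

variable {d : ℕ} {𝔸 : Type*} [NormedRing 𝔸] [NormOneClass 𝔸] [NormedAlgebra ℂ 𝔸] [CompleteSpace 𝔸]

/-! ## §1 Locality of the averaging ∕ transpose tower in the background -/

section Tower

variable {U₀ U₀' : Site d → Fin d → 𝔸ˣ}

omit [NormOneClass 𝔸] in
/-- **[B7] p. 24 «`Ū^k_c` depends only on `U_b`, `b ⊂ B^k(c₋) ∪ B^k(c₊)`», block form**: if `U₀`, `U₀′` agree on the bonds of the fine `L^{j+1}`-block
`[L^{j+1}y, L^{j+1}y + (L^{j+1}−1)𝟙]` then their `j`-fold averages agree on the (level-`j`) bonds of the `L`-block `[Ly, Ly + (L−1)𝟙]` (`B7Prop1Local.avgIter_congr`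
on each such bond: its box `B^j(c₋) ∪ B^j(c₊)` lies in the fine block). [cite: Balaban1985Averaging, p.24 (sentence after (43))] -/
theorem avgIter_agreeOn_block {L : ℕ} (hL : 1 ≤ L) (j : ℕ) (y : Site d)
    (h : AgreeOn (blockBase (L ^ (j + 1)) y) (blockBase (L ^ (j + 1)) y + (((L : ℤ) ^ (j + 1)) - 1) • (1 : Site d)) U₀ U₀') :
    AgreeOn (blockBase L y) (blockBase L y + ((L : ℤ) - 1) • (1 : Site d)) (avgIter L U₀ j) (avgIter L U₀' j) := by
  intro q κ hq hqκ
  have hP : (0 : ℤ) ≤ (L : ℤ) ^ j := by positivity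
  refine avgIter_congr L hL j q κ (h.mono (fun i => ?_) (fun i => ?_))
  · have h1 := (hq i).1
    simp only [blockBase] at h1
    have h1' := mul_le_mul_of_nonneg_left h1 hP
    simp only [blockBase, loK]
    push_cast
    rw [pow_succ]
    linarith [h1', mul_assoc ((L : ℤ) ^ j) (L : ℤ) (y i)]
  · have h1 := (hq i).2
    have h2 := (hqκ i).2
    simp only [blockBase, Pi.add_apply, Pi.smul_apply, Pi.one_apply, smul_eq_mul, mul_one, e_apply] at h1 h2
    simp only [blockBase, bondHiK, Pi.add_apply, Pi.smul_apply, Pi.one_apply, smul_eq_mul, mul_one]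
    push_cast
    rw [pow_succ]
    have hm := mul_assoc ((L : ℤ) ^ j) (L : ℤ) (y i)
    split_ifs at h2 ⊢ with hi
    · have h2' := mul_le_mul_of_nonneg_left h2 hP
      have : (L : ℤ) ^ j * (q i + 1) = (L : ℤ) ^ j * q i + (L : ℤ) ^ j := by ring
      have : (L : ℤ) ^ j * ((L : ℤ) * y i + ((L : ℤ) - 1)) = (L : ℤ) ^ j * L * y i + (L : ℤ) ^ j * L - (L : ℤ) ^ j := by ring
      linarith
    · simp only [add_zero] at h2 ⊢
      have h1' := mul_le_mul_of_nonneg_left h1 hP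
      have : (L : ℤ) ^ j * ((L : ℤ) * y i + ((L : ℤ) - 1)) = (L : ℤ) ^ j * L * y i + (L : ℤ) ^ j * L - (L : ℤ) ^ j := by ring
      linarith

omit [NormOneClass 𝔸] in
/-- **The level-`j` block transporter `T_j(y(x), x) = Ū₀ʲ(Γ_{Ly(x),x})` reads the background on the fine `L^{j+1}`-block of `y(x)`** ((78)–(80); `axialFn_congr`
on the `L`-block of `y(x)` at level `j`, `avgIter_agreeOn_block`). [cite: Balaban1985Averaging, (78)–(80) p.30, p.24; Balaban1985RegularSpaces, (1.29) p.81] -/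
theorem bgT_congr_bg {L : ℕ} (hL : 1 ≤ L) (j : ℕ) (x : Site d)
    (h : AgreeOn (blockBase (L ^ (j + 1)) (blockMap L x))
      (blockBase (L ^ (j + 1)) (blockMap L x) + (((L : ℤ) ^ (j + 1)) - 1) • (1 : Site d)) U₀ U₀') :
    bgT L U₀ j (blockMap L x) x = bgT L U₀' j (blockMap L x) x := by
  unfold bgT
  have hL1 : (1 : ℤ) ≤ L := by exact_mod_cast hL
  refine axialFn_congr (avgIter_agreeOn_block hL j _ h) _ x (fun i => ?_) (inBox_blockBase_blockMap hL x)
  simp only [Pi.add_apply, Pi.smul_apply, Pi.one_apply, smul_eq_mul, mul_one]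
  constructor <;> linarith

omit [NormOneClass 𝔸] in
/-- One transpose step (3.19) reads the background through `T_j(y(x), x)` only. [cite: Balaban1985BackgroundPropagators, (3.19) p.393] -/
theorem qprimeT1_congr_bg {L : ℕ} (hL : 1 ≤ L) (j : ℕ) (ν : Site d → 𝔸) (x : Site d)
    (h : AgreeOn (blockBase (L ^ (j + 1)) (blockMap L x))
      (blockBase (L ^ (j + 1)) (blockMap L x) + (((L : ℤ) ^ (j + 1)) - 1) • (1 : Site d)) U₀ U₀') :
    qprimeT1 L U₀ j ν x = qprimeT1 L U₀' j ν x := by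
  unfold qprimeT1
  rw [bgT_congr_bg hL j x h]

omit [NormOneClass 𝔸] in
/-- **`(Q′_j(U₀)ᵀ g)(x)` reads `g` at the level-`j` block index `y_j(x)` of `x` only** ((3.19) iterated: each step evaluates at the next block index).
[cite: Balaban1985BackgroundPropagators, (3.19) p.393] -/
theorem QprimeT_congr_fun {L : ℕ} (V : Site d → Fin d → 𝔸ˣ) :
    ∀ (j : ℕ) {g g' : Site d → 𝔸} (x : Site d), g (blockMap (L ^ j) x) = g' (blockMap (L ^ j) x) →
      QprimeT L V j g x = QprimeT L V j g' x
  | 0, g, g', x, h => by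
    have h0 : blockMap (L ^ 0) x = x := by rw [pow_zero, blockMap_one]
    rw [h0] at h
    exact h
  | j + 1, g, g', x, h => by
    show QprimeT L V j (qprimeT1 L V j g) x = QprimeT L V j (qprimeT1 L V j g') x
    refine QprimeT_congr_fun V j x ?_
    simp only [qprimeT1, blockMap_blockMap, ← pow_succ]
    rw [h]

/-- **Nested blocks**: the fine `Lʲ`-block of `x` lies in its fine `L^{j+1}`-block (corner inequalities). [folklore] -/
private theorem blockBox_succ {L : ℕ} (hL : 1 ≤ L) (j : ℕ) (x : Site d) (i : Fin d) :
    blockBase (L ^ (j + 1)) (blockMap (L ^ (j + 1)) x) i ≤ blockBase (L ^ j) (blockMap (L ^ j) x) i ∧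
      blockBase (L ^ j) (blockMap (L ^ j) x) i + (((L : ℤ) ^ j) - 1) ≤
        blockBase (L ^ (j + 1)) (blockMap (L ^ (j + 1)) x) i + (((L : ℤ) ^ (j + 1)) - 1) := by
  have hP : (0 : ℤ) ≤ (L : ℤ) ^ j := by positivity
  have hbb : blockMap (L ^ (j + 1)) x = blockMap L (blockMap (L ^ j) x) := by rw [blockMap_blockMap, pow_succ]
  have hx := inBox_blockBase_blockMap hL (blockMap (L ^ j) x) i
  simp only [blockBase, Pi.add_apply, Pi.smul_apply, Pi.one_apply, smul_eq_mul, mul_one] at hx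
  have h1 := mul_le_mul_of_nonneg_left hx.1 hP
  have h2 := mul_le_mul_of_nonneg_left hx.2 hP
  rw [hbb]
  simp only [blockBase]
  push_cast
  rw [pow_succ]
  have e1 : (L : ℤ) ^ j * ((L : ℤ) * blockMap L (blockMap (L ^ j) x) i) = (L : ℤ) ^ j * L * blockMap L (blockMap (L ^ j) x) i := by ring
  have e2 : (L : ℤ) ^ j * ((L : ℤ) * blockMap L (blockMap (L ^ j) x) i + ((L : ℤ) - 1)) =
      (L : ℤ) ^ j * L * blockMap L (blockMap (L ^ j) x) i + (L : ℤ) ^ j * L - (L : ℤ) ^ j := by ring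
  constructor <;> linarith

omit [NormOneClass 𝔸] in
/-- ★ **`(Q′_j(U₀)ᵀ g)(x)` reads the background on the fine `Lʲ`-block of `x`** ((3.19), [B7] p. 24): induction on `j` — the outer `Q′_{j}ᵀ` by the inductive
hypothesis (nested blocks), the innermost step by `qprimeT1_congr_bg` at the block index `y_j(x)` (its `L^{j+1}`-block is the `L^{j+1}`-block of `x`) and
`QprimeT_congr_fun`. [cite: Balaban1985BackgroundPropagators, (3.19) p.393; Balaban1985Averaging, p.24 (sentence after (43)), (78)–(80) p.30] -/
theorem QprimeT_congr_bg {L : ℕ} (hL : 1 ≤ L) :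
    ∀ (j : ℕ) (g : Site d → 𝔸) (x : Site d),
      AgreeOn (blockBase (L ^ j) (blockMap (L ^ j) x)) (blockBase (L ^ j) (blockMap (L ^ j) x) + (((L : ℤ) ^ j) - 1) • (1 : Site d)) U₀ U₀' →
      QprimeT L U₀ j g x = QprimeT L U₀' j g x
  | 0, g, x, _ => rfl
  | j + 1, g, x, h => by
    show QprimeT L U₀ j (qprimeT1 L U₀ j g) x = QprimeT L U₀' j (qprimeT1 L U₀' j g) x
    have hsub : AgreeOn (blockBase (L ^ j) (blockMap (L ^ j) x))
        (blockBase (L ^ j) (blockMap (L ^ j) x) + (((L : ℤ) ^ j) - 1) • (1 : Site d)) U₀ U₀' :=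
      h.mono (fun i => (blockBox_succ hL j x i).1) (fun i => by
        have := (blockBox_succ hL j x i).2
        simpa only [Pi.add_apply, Pi.smul_apply, Pi.one_apply, smul_eq_mul, mul_one] using this)
    rw [QprimeT_congr_bg hL j (qprimeT1 L U₀ j g) x hsub]
    refine QprimeT_congr_fun U₀' j x (qprimeT1_congr_bg hL j g _ ?_)
    have hbb : blockMap L (blockMap (L ^ j) x) = blockMap (L ^ (j + 1)) x := by rw [blockMap_blockMap, pow_succ]
    rw [hbb]
    exact h

/-- The fine `Lʲ`-block of `x` lies in the ball `[x − (Lʲ−1)𝟙, x + (Lʲ−1)𝟙]`. [folklore] -/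
private theorem inBox_ball_of_block {L : ℕ} (hL : 1 ≤ L) (j : ℕ) (x z : Site d)
    (hz : InBox (blockBase (L ^ j) (blockMap (L ^ j) x)) (blockBase (L ^ j) (blockMap (L ^ j) x) + (((L : ℤ) ^ j) - 1) • (1 : Site d)) z) :
    InBox (x - (((L : ℤ) ^ j) - 1) • (1 : Site d)) (x + (((L : ℤ) ^ j) - 1) • (1 : Site d)) z := by
  have hLj : 1 ≤ L ^ j := Nat.one_le_pow _ _ hL
  intro i
  have hx := inBox_blockBase_blockMap hLj x i
  have h1 := hz i
  simp only [Pi.add_apply, Pi.sub_apply, Pi.smul_apply, Pi.one_apply, smul_eq_mul, mul_one, Nat.cast_pow] at hx h1 ⊢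
  constructor <;> linarith [hx.1, hx.2, h1.1, h1.2]

omit [NormOneClass 𝔸] in
/-- ★ **`(Q′(U₀)ᵀμ)(x)` AT TRUNCATION `m` READS THE BACKGROUND ON THE BALL OF RADIUS `Lᵐ − 1` ABOUT `x`** ((3.24): the sum over `j ≤ m` of `Q′_jᵀ`, each reading the
`Lʲ`-block of `x`, `Lʲ ≤ Lᵐ`). [cite: Balaban1985BackgroundPropagators, (3.24) p.394, (3.19) p.393; Balaban1985RegularSpaces, (1.29) p.81, (1.38) p.82] -/
theorem QT_congr_bg {L : ℕ} (hL : 1 ≤ L) (m : ℕ) (Λs : ℕ → Set (Site d)) (μ : ℕ → Site d → 𝔸) (x : Site d)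
    (h : AgreeOn (x - (((L : ℤ) ^ m) - 1) • (1 : Site d)) (x + (((L : ℤ) ^ m) - 1) • (1 : Site d)) U₀ U₀') :
    QT L m Λs U₀ μ x = QT L m Λs U₀' μ x := by
  unfold QT
  refine Finset.sum_congr rfl fun j hj => QprimeT_congr_bg hL j _ x fun z κ hz hzκ => ?_
  have hjm : j ≤ m := Nat.lt_succ_iff.mp (Finset.mem_range.mp hj)
  have hpow : (L : ℤ) ^ j ≤ (L : ℤ) ^ m := pow_le_pow_right₀ (by exact_mod_cast hL) hjm
  have hz' := inBox_ball_of_block hL j x z hz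
  have hzκ' := inBox_ball_of_block hL j x _ hzκ
  refine h z κ (fun i => ?_) (fun i => ?_)
  · have := hz' i
    simp only [Pi.add_apply, Pi.sub_apply, Pi.smul_apply, Pi.one_apply, smul_eq_mul, mul_one] at this ⊢
    constructor <;> linarith [this.1, this.2]
  · have := hzκ' i
    simp only [Pi.add_apply, Pi.sub_apply, Pi.smul_apply, Pi.one_apply, smul_eq_mul, mul_one] at this ⊢
    constructor <;> linarith [this.1, this.2]

end Tower

/-! ## §2 The per-member curved (1.59) at all truncations with the background constrained near the member only -/

section Local

set_option maxHeartbeats 400000 in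
-- one long transfer proof (the modified background and the locality read-backs); twice the default budget, no heavy automation
/-- ★★★ **(1.59) AT A CURVED BACKGROUND ON THE CUBE MEMBER, PER MEMBER, ALL TRUNCATIONS `1 ≤ m ≤ k`, BACKGROUND CONSTRAINED ON `□₀ + (Lᵐ + 3)` ONLY.**  With the
SAME `δ₀(□, m) > 0`, `B′(□, m) > 0` as `B8Ineq159CurvedCubeMemberPerCubeTower.exists_curved159_perCube` ([B7] Prop. 2's regime: `2 ≤ L`, `G` an averaging-closed
group) and the collar side condition `L ≤ ρ`: for every `G`-valued background `U₀` with `‖U₀(y, κ) − 1‖ ≤ δ₀` for the bonds BASED IN THE BOX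
`[sqLo₀ − (Lᵐ+3)𝟙, sqHi₀ + (Lᵐ+3)𝟙]` (no closeness condition elsewhere), every `𝔸`-valued `φ` in the curved Landau gauge (1.38) of `U₀` at truncation `m`
(multiplier form, `Λ′`-tower `cubeLamS … m`) supported on the side-touching bonds of the `□_j`, `j ≤ m`, and every `N ≥ 0` bounding (i) `(Lʲη)³|J_{U₀}φ|` on the
bonds of `□_j`, (ii) `|Lʲη·Q_j(U₀)(iηφ)|` on print's class `cubeLamBP … m j`, (iii) `η|φ|` on the outer layer: `(Lʲη)|φ|, (Lʲη)²|D^η_{U₀,ν}φ_τ|, (Lʲη)³|Δ^η_{U₀}φ_τ|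
≤ B′N` on the sides of `□_j`, `j ≤ m`.  PROOF: `U₀′ := U₀` on the box, `1` off it, is `G`-valued and `δ₀`-close to `1` on all of `ℤᵈ`; the Landau identity at
`x ∈ □₀` reads the radius-`2` ball (stencil, file (F)) and the radius-`(Lᵐ−1)` ball (`QT_congr_bg`); the current ∕ targets read radius-`≤ 2` balls about
bonds touching `□_j ⊆ □₀`; the class bonds' boxes lie in `□₀` (`j ≥ 1`, `cubeLamBP_box_subset_pred`) or are the bond itself (`j = 0`); file (D′) at `U₀′`.
HONEST SCOPE in the module docstring (per member ∕ truncation, non-explicit, neighbourhood box, NOT [4] Thm 3.3).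
[cite: Balaban1985RegularSpaces, (1.59) p.86, (1.62) p.87, (1.38) p.82, (1.131) p.99; Balaban1985Averaging, p.24 (sentence after (43)), (78)–(80) p.30, Prop. 2 (52)–(54) p.26; Balaban1985BackgroundPropagators, (3.19) p.393, (3.23)–(3.25) p.394, Thm 3.3 p.399] -/
theorem exists_curved159_perCube_local [FiniteDimensional ℂ 𝔸] (hd2 : 2 ≤ d) {L : ℕ} (hL2 : 2 ≤ L) {η : ℝ} (hη : 0 < η)
    {G : Subgroup 𝔸ˣ} (hG : AvgClosed d L G) (a : Site d) (M : ℕ) {ρ : ℕ} (hρ : L ≤ ρ) {k m : ℕ} (hm1 : 1 ≤ m) (hmk : m ≤ k) :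
    ∃ δ₀ B' : ℝ, 0 < δ₀ ∧ 0 < B' ∧ ∀ (U₀ : Site d → Fin d → 𝔸ˣ), (∀ x κ, U₀ x κ ∈ G) →
      (∀ (x : Site d) (κ : Fin d),
          InBox (sqLo L a ρ k 0 - (((L : ℤ) ^ m) + 3) • (1 : Site d)) (sqHi L a M ρ k 0 + (((L : ℤ) ^ m) + 3) • (1 : Site d)) x →
          ‖((U₀ x κ : 𝔸ˣ) : 𝔸) - 1‖ ≤ δ₀) →
      ∀ φ : Site d → Fin d → 𝔸,
        IsLandau138 L m η (cubeFam false L a M ρ k 0) (cubeLamS L a M ρ k m) U₀ φ →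
        (∀ (y : Site d) (τ : Fin d), (∀ j, j ≤ m → ¬ SideTouches (cubeFam false L a M ρ k j) y τ) → φ y τ = 0) →
        ∀ N : ℝ, 0 ≤ N →
          (∀ j, j ≤ m → ∀ (y : Site d) (τ : Fin d), BondTouches (cubeFam false L a M ρ k j) y τ →
              ((L : ℝ) ^ j * η) ^ 3 * ‖Jcur η U₀ φ τ y‖ ≤ N) →
          (∀ j, j ≤ m → ∀ c ∈ cubeLamBP L a M ρ k m j, ‖linCovIter L U₀ (iEta η φ) j c.1 c.2‖ ≤ N) →
          (∀ (y : Site d) (τ : Fin d), ¬ BondTouches (cubeFam false L a M ρ k 0) y τ → η * ‖φ y τ‖ ≤ N) →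
          ∀ j, j ≤ m → ∀ (y : Site d) (τ : Fin d), SideTouches (cubeFam false L a M ρ k j) y τ →
            ((L : ℝ) ^ j * η) * ‖φ y τ‖ ≤ B' * N ∧
            (∀ ν : Fin d, ((L : ℝ) ^ j * η) ^ 2 * ‖covDerivFwd η U₀ ν (fun z => φ z τ) y‖ ≤ B' * N) ∧
            ((L : ℝ) ^ j * η) ^ 3 * ‖covLap η U₀ (fun z => φ z τ) y‖ ≤ B' * N := by
  classical
  have hL : 1 ≤ L := le_trans (by norm_num) hL2
  obtain ⟨δ₀, B', hδ₀, hB', H⟩ := exists_curved159_perCube (𝔸 := 𝔸) hd2 hL2 hη hG a M ρ hm1 hmk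
  refine ⟨δ₀, B', hδ₀, hB', ?_⟩
  intro U₀ hU hδ φ hLan hs N hN h1 h2 h3 j hj y τ hst
  have hmk' : m ≤ k := hmk
  -- the radius and the box
  obtain ⟨R, hR⟩ : ∃ R : ℤ, R = (L : ℤ) ^ m := ⟨_, rfl⟩
  have hR1 : 1 ≤ R := by rw [hR]; exact_mod_cast Nat.one_le_pow _ _ hL
  obtain ⟨lo, hlo⟩ : ∃ lo : Site d, lo = sqLo L a ρ k 0 - (((L : ℤ) ^ m) + 3) • (1 : Site d) := ⟨_, rfl⟩
  obtain ⟨hi, hhi⟩ : ∃ hi : Site d, hi = sqHi L a M ρ k 0 + (((L : ℤ) ^ m) + 3) • (1 : Site d) := ⟨_, rfl⟩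
  have hlo_i : ∀ i, lo i = sqLo L a ρ k 0 i - (R + 3) := fun i => by
    rw [hlo, hR]; simp only [Pi.sub_apply, Pi.smul_apply, Pi.one_apply, smul_eq_mul, mul_one]
  have hhi_i : ∀ i, hi i = sqHi L a M ρ k 0 i + (R + 3) := fun i => by
    rw [hhi, hR]; simp only [Pi.add_apply, Pi.smul_apply, Pi.one_apply, smul_eq_mul, mul_one]
  obtain ⟨U₀', hU₀'⟩ : ∃ U₀' : Site d → Fin d → 𝔸ˣ, U₀' = fun x κ => if InBox lo hi x then U₀ x κ else 1 := ⟨_, rfl⟩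
  have hagree : ∀ (x : Site d) (κ : Fin d), InBox lo hi x → U₀' x κ = U₀ x κ := fun x κ hx => by
    rw [hU₀']; exact if_pos hx
  have hU' : ∀ x κ, U₀' x κ ∈ G := by
    intro x κ; rw [hU₀']
    show (if InBox lo hi x then U₀ x κ else 1) ∈ G
    split_ifs
    · exact hU x κ
    · exact G.one_mem
  have hδ' : ∀ x κ, ‖((U₀' x κ : 𝔸ˣ) : 𝔸) - 1‖ ≤ δ₀ := by
    intro x κ
    by_cases hx : InBox lo hi x
    · rw [hagree x κ hx]; rw [hlo, hhi] at hx; exact hδ x κ hx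
    · have : U₀' x κ = 1 := by rw [hU₀']; exact if_neg hx
      rw [this, Units.val_one, sub_self, norm_zero]; exact hδ₀.le
  -- geometric facts: `□₀ = [sqLo₀, sqHi₀]`, `□_j ⊆ □₀`
  have hΩ0 : cubeFam false L a M ρ k 0 = cube L a M ρ k 0 := cubeFam_false_zero L a M ρ k
  have hcubej : ∀ j', j' ≤ m → cubeFam false L a M ρ k j' ⊆ {x | InBox (sqLo L a ρ k 0) (sqHi L a M ρ k 0) x} := by
    intro j' hj'
    rw [cubeFam_false_of_le L a M ρ (hj'.trans hmk')]
    exact cube_anti (Nat.zero_le j') (hj'.trans hmk')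
  -- agreement on balls: everything within `R + 3` of `□₀`
  have hball : ∀ (x : Site d) (r : ℤ), 0 ≤ r → (∀ i, sqLo L a ρ k 0 i - (R + 3) + r ≤ x i ∧ x i ≤ sqHi L a M ρ k 0 i + (R + 3) - r) →
      ∀ (y' : Site d) (κ : Fin d), (∀ i, x i - r ≤ y' i ∧ y' i ≤ x i + r) → U₀ y' κ = U₀' y' κ := by
    intro x r hr hx y' κ hy'
    refine (hagree y' κ fun i => ?_).symm
    rw [hlo_i, hhi_i]
    have h1 := hx i; have h2 := hy' i
    constructor <;> linarith [h1.1, h1.2, h2.1, h2.2]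
  -- (o) the Landau condition transfers (same multiplier): stencil on the radius-2 ball, transpose tower on the radius-`(R−1)` ball, inside the box for `x ∈ □₀`
  have hLan' : IsLandau138 L m η (cubeFam false L a M ρ k 0) (cubeLamS L a M ρ k m) U₀' φ := by
    obtain ⟨μ, hμ⟩ := hLan
    refine ⟨μ, fun x hx => ?_⟩
    have hxb : InBox (sqLo L a ρ k 0) (sqHi L a M ρ k 0) x := by rw [hΩ0, mem_cube_zero_iff] at hx; exact hx
    have e1 := landauStencil_congr_bg (η := η) (cubeFam false L a M ρ k 0) φ x
      (hball x 2 (by norm_num) (fun i => by have := hxb i; constructor <;> linarith [this.1, this.2]))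
    have e2 : QT L m (cubeLamS L a M ρ k m) U₀ μ x = QT L m (cubeLamS L a M ρ k m) U₀' μ x := by
      refine QT_congr_bg hL m _ μ x fun z κ hz _ => ?_
      rw [← hR] at hz
      exact hball x (R - 1) (by linarith) (fun i => by have := hxb i; constructor <;> linarith [this.1, this.2]) z κ
        (fun i => by
          have := hz i
          simpa only [Pi.sub_apply, Pi.add_apply, Pi.smul_apply, Pi.one_apply, smul_eq_mul, mul_one] using this)
    rw [← e1, ← e2]; exact hμ x hx
  -- (i) the current at the touching bonds
  have h1' : ∀ j, j ≤ m → ∀ (y : Site d) (τ : Fin d), BondTouches (cubeFam false L a M ρ k j) y τ →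
      ((L : ℝ) ^ j * η) ^ 3 * ‖Jcur η U₀' φ τ y‖ ≤ N := by
    intro j' hj' y' τ' hbt
    have hyb : InBox (sqLo L a ρ k 0 - 1) (sqHi L a M ρ k 0) y' :=
      inBox_pred_of_bondTouches (hbt.imp (fun h => hcubej j' hj' h) (fun h => hcubej j' hj' h))
    have e := Jcur_congr_bg (η := η) φ τ' y'
      (hball y' 1 (by norm_num) (fun i => by
        have := hyb i; simp only [Pi.sub_apply, Pi.one_apply] at this; constructor <;> linarith [this.1, this.2]))
    rw [← e]; exact h1 j' hj' y' τ' hbt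
  -- (ii) the averages over print's class: the class bond's box lies in `□_{j−1} ⊆ □₀` (`j ≥ 1`) or is the bond itself (`j = 0`)
  have h2' : ∀ j, j ≤ m → ∀ c ∈ cubeLamBP L a M ρ k m j, ‖linCovIter L U₀' (iEta η φ) j c.1 c.2‖ ≤ N := by
    intro j' hj' c hc
    have e : linCovIter L U₀ (iEta η φ) j' c.1 c.2 = linCovIter L U₀' (iEta η φ) j' c.1 c.2 := by
      refine linCovIter_congr L hL j' c.1 c.2 (fun z κ hz _ => (hagree z κ ?_).symm) (fun _ _ _ _ => rfl)
      intro i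
      rw [hlo_i, hhi_i]
      rcases Nat.lt_or_ge j' 1 with h0 | h1le
      · -- `j = 0`: the box is the bond `[c.1, c.1 + e]`, and the bond touches `□₀`
        have hj0 : j' = 0 := by omega
        subst hj0
        have hbt : BondTouches (cube L a M ρ k 0) c.1 c.2 := cubeLamBP_zero_bondTouches L a M ρ k m hc
        have hcb : InBox (sqLo L a ρ k 0 - 1) (sqHi L a M ρ k 0) c.1 := inBox_pred_of_bondTouches hbt
        have h1 := hcb i; have h2 := hz i
        simp only [loK, bondHiK, pow_zero, one_mul, Pi.sub_apply, Pi.one_apply] at h1 h2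
        constructor
        · linarith [h1.1, h2.1]
        · have : z i ≤ c.1 i + 1 := by have := h2.2; split_ifs at this <;> omega
          linarith [h1.2]
      · -- `j ≥ 1`: the box lies in `□_{j−1} ⊆ □₀` (`cubeLamBP_box_subset_pred`)
        have hzc : z ∈ cube L a M ρ k (j' - 1) := cubeLamBP_box_subset_pred hL a M hρ h1le hmk' hc z hz
        have hz0 : z ∈ cube L a M ρ k 0 := cube_anti (Nat.zero_le _) (by omega) hzc
        rw [mem_cube_zero_iff] at hz0
        have := hz0 i
        constructor <;> linarith [this.1, this.2]
    rw [← e]; exact h2 j' hj' c hc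
  -- file (D′) at the modified background
  obtain ⟨t1, t2, t3⟩ := H U₀' hU' hδ' φ hLan' hs N hN h1' h2' h3 j hj y τ hst
  -- the targets read back at `U₀`: `y` side-touches `□_j ⊆ □₀`, so `y ∈ [sqLo₀ − 2, sqHi₀ + 1]`
  have hyb : InBox (sqLo L a ρ k 0 - 2) (sqHi L a M ρ k 0 + 1) y :=
    inBox_widen_of_sideTouches (B8Eq140Level.sideTouches_mono (hcubej j hj) hst)
  have hyb' : ∀ i, sqLo L a ρ k 0 i - 2 ≤ y i ∧ y i ≤ sqHi L a M ρ k 0 i + 1 := fun i => by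
    have := hyb i; simp only [Pi.sub_apply, Pi.add_apply, Pi.ofNat_apply] at this
    exact ⟨by linarith [this.1], by linarith [this.2]⟩
  refine ⟨t1, fun ν => ?_, ?_⟩
  · have e : covDerivFwd η U₀ ν (fun z => φ z τ) y = covDerivFwd η U₀' ν (fun z => φ z τ) y :=
      covDerivFwd_congr_bg ν _ y (hball y 0 le_rfl (fun i => by have := hyb' i; constructor <;> linarith [this.1, this.2]) y ν
        (fun i => ⟨by linarith, by linarith⟩))
    rw [e]; exact t2 ν
  · have e : covLap η U₀ (fun z => φ z τ) y = covLap η U₀' (fun z => φ z τ) y :=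
      covLap_congr_bg _ y (hball y 1 (by norm_num) (fun i => by have := hyb' i; constructor <;> linarith [this.1, this.2]))
    rw [e]; exact t3

end Local

end Literature.MathematicalPhysics.QuantumFieldTheory.Balaban1983to89.B8Ineq159CurvedCubeMemberLocalTower

end
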